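import Mathlib
import Summits.Ventures.PercRepro.TriangleCapRowA1Last
import Summits.Ventures.PercRepro.TriangleCapMaxDegStability3

/-!
# PercRepro — TOWARDS THE ROW `r = a + 2`: THE WINDOW AND THE ALL-OFF READ (p3, gen 47; part 200zp)

`rowA2_window`: every degree in `[a, k − a − 1]` gives the triple-broom target on `(k, a, a + 2)` (slack
`(a − 2) k − a² + a + 16`). `rowA2_alloff`: `D − z ⊆ K(A′, A′ᶜ)` with every neighbour of `z` off `A′` makes `D`
`(a + 1)`-bipartite with `s = k − a + 1` missing pairs and no vertex missing `s − 2` of them, and the stability at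
`Δ ≤ s − 3` (part 200zh) gives the target EXACTLY: `(k − a + 1)(a − 2) + 6 (k − a − 3) = (a + 2)(k − a − 3) +
(2k + 2a − 14)`. Axioms: standard.
-/

namespace PercRepro

namespace TriangleCap

namespace C047

open Finset

variable {V : Type*} [Fintype V] [DecidableEq V]

omit [DecidableEq V] in
/-- **THE WINDOW `[a, k − a − 1]` ON `(k, a, a + 2)`:** every degree in `[a, k − a − 1]` gives
`Σ_v d(v)² + (a + 2)(k − 1 − (a + 2)) + (2k + 2a − 14) ≤ m k` (`5 ≤ a`, `3a + 2 ≤ k`; slack `(a − 2) k − a² + a + 16`). -/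
theorem rowA2_window (D : SimpleGraph V) [DecidableRel D.Adj] (a : ℕ) (ha5 : 5 ≤ a)
    (hk : 3 * a + 2 ≤ Fintype.card V) (hm : D.edgeFinset.card + (a + 2) = a * (Fintype.card V - a))
    (hcap : ∀ v, deg D v + a + 1 ≤ Fintype.card V) (hdeg : ∀ v, a ≤ deg D v) :
    ∑ v, deg D v * deg D v + (a + 2) * (Fintype.card V - 1 - (a + 2)) + (2 * Fintype.card V + 2 * a - 14) ≤
      D.edgeFinset.card * Fintype.card V := by
  have hsum : ∑ v, (deg D v * deg D v + a * (Fintype.card V - a - 1)) ≤ ∑ v, (Fintype.card V - 1) * deg D v :=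
    sum_le_sum (fun v _ => convex_vertex_window (deg D v) (Fintype.card V) a (hdeg v) (hcap v))
  rw [sum_add_distrib, sum_const, card_univ, smul_eq_mul, ← mul_sum, sum_deg_eq] at hsum
  obtain ⟨k, hk'⟩ : ∃ k, Fintype.card V = k := ⟨_, rfl⟩
  obtain ⟨S, hS⟩ : ∃ S, ∑ v, deg D v * deg D v = S := ⟨_, rfl⟩
  obtain ⟨m, hmdef⟩ : ∃ m, D.edgeFinset.card = m := ⟨_, rfl⟩
  rw [hk'] at hsum hm hk
  rw [hS, hmdef] at hsum
  rw [hmdef] at hm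
  rw [hS, hk', hmdef]
  obtain ⟨q, rfl⟩ : ∃ q, a = q + 5 := ⟨a - 5, by omega⟩
  obtain ⟨c, rfl⟩ : ∃ c, k = 3 * (q + 5) + 2 + c := ⟨k - (3 * (q + 5) + 2), by omega⟩
  have e1 : 3 * (q + 5) + 2 + c - (q + 5) - 1 = 2 * q + 11 + c := by omega
  have e2 : 3 * (q + 5) + 2 + c - 1 = 3 * q + 16 + c := by omega
  have e3 : 3 * (q + 5) + 2 + c - (q + 5) = 2 * q + 12 + c := by omega
  have e4 : 3 * (q + 5) + 2 + c - 1 - (q + 5 + 2) = 2 * q + 9 + c := by omega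
  have e5 : 2 * (3 * (q + 5) + 2 + c) + 2 * (q + 5) - 14 = 8 * q + 30 + 2 * c := by omega
  rw [e1, e2] at hsum
  rw [e3] at hm
  rw [e4, e5]
  nlinarith [hsum, hm]

/-- **THE ALL-OFF READ ON `(k, a, a + 2)`:** `D − z ⊆ K(A′, A′ᶜ)`, every neighbour of `z` off `A′`, some neighbour
`w₀` ⇒ the target, EXACTLY (the other bipartition has `s = k − a + 1` missing pairs, no vertex missing `s − 2` of
them, and `closed_form_stability_bipSub_maxdeg3` gives `(k − a + 1)(a − 2) + 6 (k − a − 3) = (a + 2)(k − a − 3) +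
(2k + 2a − 14)`). -/
theorem rowA2_alloff (D : SimpleGraph V) [DecidableRel D.Adj] (a : ℕ) (ha5 : 5 ≤ a)
    (hk : 3 * a + 2 ≤ Fintype.card V) (hm : D.edgeFinset.card + (a + 2) = a * (Fintype.card V - a)) (z : V)
    (hz : deg D z + 1 ≤ a) (A' : Finset {v : V // v ≠ z}) (hA'card : A'.card = a) (hB : BipSub (del D z) A')
    (hm' : (del D z).edgeFinset.card + (deg D z + 2) = a * (Fintype.card {v : V // v ≠ z} - a))
    (hnone : ∀ w : {v : V // v ≠ z}, D.Adj w.1 z → w ∉ A') (w₀ : {v : V // v ≠ z}) (hw₀z : D.Adj w₀.1 z) :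
    ∑ v, deg D v * deg D v + (a + 2) * (Fintype.card V - 1 - (a + 2)) + (2 * Fintype.card V + 2 * a - 14) ≤
      D.edgeFinset.card * Fintype.card V := by
  have hcard' := card_del z
  have hz1 : 1 ≤ deg D z := by
    have := card_nbhd_del D z
    have hmem : w₀ ∈ univ.filter (fun w : {v : V // v ≠ z} => D.Adj w.1 z) := by
      rw [mem_filter]; exact ⟨mem_univ _, hw₀z⟩
    have := card_pos.mpr ⟨w₀, hmem⟩
    omega
  have hAsub := bipSub_insert_map D z A' hB hnone
  have hAcard := card_insert_map z A'
  rw [hA'card] at hAcard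
  have hedges : D.edgeFinset.card + (Fintype.card V - a + 1) = (a + 1) * (Fintype.card V - (a + 1)) := by
    have h := below_bip_edges a (a + 2) (Fintype.card V) D.edgeFinset.card (by omega) hm
    have e : Fintype.card V - 2 * a - 1 + (a + 2) = Fintype.card V - a + 1 := by omega
    rw [e] at h
    exact h
  -- no vertex misses `k − a − 1` pairs of the other bipartition
  have hmissdel := card_edges_missingGraph (del D z) A' hB a (deg D z + 2) hA'card hm'
  have hmax : ∀ v, deg (missingGraph D (insert z (A'.map (Function.Embedding.subtype _)))) v + 3 ≤
      Fintype.card V - a + 1 := by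
    intro v
    have h := deg_add_deg_missingGraph D _ hAsub v
    rw [hAcard] at h
    by_cases hvA : v ∈ insert z (A'.map (Function.Embedding.subtype _))
    · rw [if_pos hvA] at h
      -- `v = z` has degree `d ≥ 1`; `v ∈ A′` keeps `≥ k − 2a − 1 ≥ 1` edges
      have hdeg1 : 1 ≤ deg D v := by
        rw [mem_insert, mem_map] at hvA
        rcases hvA with rfl | ⟨w, hwA, hwv⟩
        · exact hz1
        · have hdel := deg_del D z w
          have hwz : ¬ D.Adj w.1 z := fun h => hnone w h hwA
          rw [if_neg hwz, add_zero] at hdel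
          have hmiss := deg_add_deg_missingGraph (del D z) A' hB w
          rw [if_pos hwA, hA'card] at hmiss
          have ec : Fintype.card {v : V // v ≠ z} = Fintype.card V - 1 := by omega
          rw [ec] at hmiss
          have hle := deg_le_card_edges' (missingGraph (del D z) A') w
          rw [hmissdel] at hle
          simp only [Function.Embedding.coe_subtype] at hwv
          rw [← hwv, ← hdel]
          omega
      omega
    · rw [if_neg hvA] at h
      omega
  have h := closed_form_stability_bipSub_maxdeg3 D _ hAsub (a + 1) (Fintype.card V - a + 1) hAcard hedges (by omega)
    (by omega) hmax
  have e1 : Fintype.card V - 1 - (Fintype.card V - a + 1) = a - 2 := by omega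
  rw [e1] at h
  have e2 : (Fintype.card V - a + 1) * (a - 2) + 6 * (Fintype.card V - a + 1 - 4) =
      (a + 2) * (Fintype.card V - 1 - (a + 2)) + (2 * Fintype.card V + 2 * a - 14) := by
    obtain ⟨q, rfl⟩ : ∃ q, a = q + 5 := ⟨a - 5, by omega⟩
    obtain ⟨c, hc⟩ : ∃ c, Fintype.card V = 3 * (q + 5) + 2 + c := ⟨Fintype.card V - (3 * (q + 5) + 2), by omega⟩
    rw [hc]
    have f1 : 3 * (q + 5) + 2 + c - (q + 5) + 1 = 2 * q + 13 + c := by omega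
    have f2 : q + 5 - 2 = q + 3 := by omega
    have f3 : 2 * q + 13 + c - 4 = 2 * q + 9 + c := by omega
    have f4 : 3 * (q + 5) + 2 + c - 1 - (q + 5 + 2) = 2 * q + 9 + c := by omega
    have f5 : 2 * (3 * (q + 5) + 2 + c) + 2 * (q + 5) - 14 = 8 * q + 30 + 2 * c := by omega
    rw [f1, f2, f3, f4, f5]
    ring
  omega

end C047

end TriangleCap

end PercRepro
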